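import Summits.QuantumAdvantage.QuantumAdvantage.Theorems.LinnikCubicClassGroupsDegreeOnePrimesEscapeOdlyzkoDiscriminantBoundNumeric
import HarnessLib

/-!
# Odlyzko's root-discriminant bounds `|d_K|^{1/n} ≳ 51.7^{r₁/n} · 20.18^{2r₂/n}` (one difference)

Topic `Summits/QuantumAdvantage/QuantumAdvantage/Theorems`, helper file for the crux
`DegreeOnePrimesEscape` (stmt-QuantumAdvantage-11543, closed) of route `LinnikCubicClassGroups`;
cell B2b-1 (linnik-cubic), PART A. HONEST FRAMING: the value of this file is a THEOREM (explicit,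
kernel-checked discriminant bounds) — NOT summit progress.

From `OdlyzkoBound.log_absdiscr_ge_odlyzko_signature` (companion file:
`log|d_K| ≥ r₁(log 4π + γ + 0.838) + 2r₂(log 2π + γ + 0.59) − 2√(π²n/2) − 60` for every number field):

* `lt_four_pi_exp_gain`, `lt_two_pi_exp_gain` — `51.7 < 4πe^{γ+0.838}`, `20.18 < 2πe^{γ+0.59}`;
* `absdiscr_ge_odlyzko_numeric(_totallyReal)` — **`|d_K| ≥ 20.18^n e^{−2√(π²n/2) − 60}` for every
  number field `K` of degree `n`, `|d_K| ≥ 51.7^n e^{−2√(π²n/2) − 60}` for totally real `K`**;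
* `exists_pow_le_absdiscr_of_lt_odlyzko(_totallyReal)` — **asymptotic root-discriminant bounds: for
  every `θ < 2πe^{γ+0.59} ≈ 20.19` (resp. `θ < 4πe^{γ+0.838} ≈ 51.74`) there is `N` with
  `θ^n ≤ |d_K|` for every (resp. every totally real) number field of degree `n ≥ N`**
  (tree before: `11.19`, `22.38` — `Discriminant.exists_pow_le_absdiscr_of_lt`, Stark's method;
  Odlyzko's optimum by differencing `22.2`, `60.1` [Odlyzko1977, (4)]; the geometry-of-numbers
  record of Rogers–Mulholland `15.77`, `32.56` is superseded);
* `finrank_le_log_absdiscr_odlyzko` — `n ≤ (log|d_K| + 84)/log 16` for every number field.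

## References

* A. M. Odlyzko, *Lower bounds for discriminants of number fields. II*, Tôhoku Math. J. 29 (1977)
  209–216. [Odlyzko1977]
* A. M. Odlyzko, *Lower bounds for discriminants of number fields*, Acta Arith. 29 (1976) 275–297.
  [Odlyzko1976]
-/


noncomputable section

open scoped NumberField
open Complex Filter Topology Set NumberField NumberField.InfinitePlace

namespace Summit.QuantumAdvantage.QuantumAdvantage.Theorems.DegreeOnePrimesEscape

namespace OdlyzkoBound

open Literature.NumberTheory.LFunctions Literature.NumberTheory.LFunctions.NumberField

variable (K : Type*) [Field K] [NumberField K]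

/-! ### Numerics: `4πe^{γ+0.838} > 51.7`, `2πe^{γ+0.59} > 20.18` -/

/-- `e^{0.838} ≥ 2.3111`. [folklore] -/
private theorem exp_0838_ge : (2.3111 : ℝ) ≤ Real.exp 0.838 := by
  have h2 := Real.sum_le_exp_of_nonneg (show (0 : ℝ) ≤ 0.838 by norm_num) 7
  have h3 : (2.3111 : ℝ) ≤ ∑ i ∈ Finset.range 7, (0.838 : ℝ) ^ i / (i.factorial : ℝ) := by
    simp only [Finset.sum_range_succ, Finset.sum_range_zero, Nat.factorial]
    norm_num
  linarith

/-- `e^{0.59} ≥ 1.80392`. [folklore] -/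
private theorem exp_059_ge : (1.80392 : ℝ) ≤ Real.exp 0.59 := by
  have h2 := Real.sum_le_exp_of_nonneg (show (0 : ℝ) ≤ 0.59 by norm_num) 7
  have h3 : (1.80392 : ℝ) ≤ ∑ i ∈ Finset.range 7, (0.59 : ℝ) ^ i / (i.factorial : ℝ) := by
    simp only [Finset.sum_range_succ, Finset.sum_range_zero, Nat.factorial]
    norm_num
  linarith

/-- **`4πe^{γ+0.838} > 51.7`** (the real-place constant of the one-difference bound; Stark's method:
`4πe^γ ≈ 22.38`, Odlyzko's optimum by differencing `60.1`, by explicit formulae `60.8`). [folklore] -/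
theorem lt_four_pi_exp_gain :
    (51.7 : ℝ) < 4 * Real.pi * Real.exp (Real.eulerMascheroniConstant + 0.838) := by
  have h := Discriminant.lt_four_pi_exp_eulerMascheroni
  have he := exp_0838_ge
  rw [Real.exp_add, ← mul_assoc]
  nlinarith [Real.exp_pos Real.eulerMascheroniConstant, Real.pi_pos]

/-- **`2πe^{γ+0.59} > 20.18`** (the complex-place constant of the one-difference bound; Stark's
method: `2πe^γ ≈ 11.19`, Odlyzko's optimum by differencing `22.2`, by explicit formulae `22.38`).
[folklore] -/
theorem lt_two_pi_exp_gain :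
    (20.18 : ℝ) < 2 * Real.pi * Real.exp (Real.eulerMascheroniConstant + 0.59) := by
  have h := Discriminant.lt_two_pi_exp_eulerMascheroni
  have he := exp_059_ge
  rw [Real.exp_add, ← mul_assoc]
  nlinarith [Real.exp_pos Real.eulerMascheroniConstant, Real.pi_pos]

/-- **Numeric form**: `|d_K| ≥ 20.18^n · e^{−2√(π²n/2) − 60}` for every number field `K` of degree
`n` (real places counted with the smaller constant). [cite: Odlyzko1977, Theorem 1 (method)] -/
theorem absdiscr_ge_odlyzko_numeric :
    (20.18 : ℝ) ^ Module.finrank ℚ K *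
        Real.exp (-(2 * Real.sqrt (Real.pi ^ 2 * Module.finrank ℚ K / 2) + 60)) ≤
      ((discr K).natAbs : ℝ) := by
  have h := absdiscr_ge_odlyzko_signature K
  have h4 := lt_four_pi_exp_gain
  have h2 := lt_two_pi_exp_gain
  have h42 : 2 * Real.pi * Real.exp (Real.eulerMascheroniConstant + 0.59) ≤
      4 * Real.pi * Real.exp (Real.eulerMascheroniConstant + 0.838) := by
    have := Real.exp_le_exp.2
      (show Real.eulerMascheroniConstant + 0.59 ≤ Real.eulerMascheroniConstant + 0.838 by norm_num)
    nlinarith [Real.exp_pos (Real.eulerMascheroniConstant + 0.59), Real.pi_pos]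
  have hrank : nrRealPlaces K + 2 * nrComplexPlaces K = Module.finrank ℚ K :=
    card_add_two_mul_card_eq_rank K
  refine le_trans ?_ h
  gcongr ?_ * _
  calc (20.18 : ℝ) ^ Module.finrank ℚ K
      = 20.18 ^ nrRealPlaces K * 20.18 ^ (2 * nrComplexPlaces K) := by rw [← pow_add, hrank]
    _ ≤ (4 * Real.pi * Real.exp (Real.eulerMascheroniConstant + 0.838)) ^ nrRealPlaces K *
          (2 * Real.pi * Real.exp (Real.eulerMascheroniConstant + 0.59)) ^ (2 * nrComplexPlaces K) := by
        gcongr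
        · linarith

/-- **Numeric form, totally real fields**: `|d_K| ≥ 51.7^n · e^{−2√(π²n/2) − 60}` for every totally
real number field `K` of degree `n`. [cite: Odlyzko1977, Theorem 1 (method)] -/
theorem absdiscr_ge_odlyzko_numeric_totallyReal [IsTotallyReal K] :
    (51.7 : ℝ) ^ Module.finrank ℚ K *
        Real.exp (-(2 * Real.sqrt (Real.pi ^ 2 * Module.finrank ℚ K / 2) + 60)) ≤
      ((discr K).natAbs : ℝ) := by
  have h := absdiscr_ge_odlyzko_signature K
  have h4 := lt_four_pi_exp_gain
  rw [IsTotallyReal.nrComplexPlaces_eq_zero, mul_zero, pow_zero, mul_one,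
    ← IsTotallyReal.finrank] at h
  refine le_trans ?_ h
  gcongr

/-! ### Asymptotic root-discriminant bounds -/

/-- Elementary step: for `δ > 0` there is `N` such that `2√(π²n/2) + 60 ≤ δ·n` for all `n ≥ N`.
[folklore] -/
theorem exists_sqrt_error_le_sixty {δ : ℝ} (hδ : 0 < δ) :
    ∃ N : ℕ, ∀ n : ℕ, N ≤ n → 2 * Real.sqrt (Real.pi ^ 2 * n / 2) + 60 ≤ δ * n := by
  obtain ⟨N₁, hN₁⟩ := Discriminant.exists_sqrt_error_le (half_pos hδ)
  obtain ⟨N₂, hN₂⟩ := exists_nat_ge (116 / δ)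
  refine ⟨max N₁ N₂, fun n hn ↦ ?_⟩
  have h1 := hN₁ n (le_trans (le_max_left _ _) hn)
  have h2 : (116 / δ : ℝ) ≤ n := le_trans hN₂ (by exact_mod_cast le_trans (le_max_right _ _) hn)
  have h3 : 116 ≤ δ * n := by
    have := (div_le_iff₀ hδ).1 h2
    linarith
  linarith

/-- **Asymptotic root-discriminant bound (Odlyzko's differencing method, one difference)**: for
every `θ < 2πe^{γ+0.59} ≈ 20.19` there is `N` such that `|d_K| ≥ θ^n` for every number field `K` of
degree `n ≥ N`. [cite: Odlyzko1977, Theorem 1 (method; one-term instance)] -/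
theorem exists_pow_le_absdiscr_of_lt_odlyzko {θ : ℝ} (hθ0 : 0 ≤ θ)
    (hθ : θ < 2 * Real.pi * Real.exp (Real.eulerMascheroniConstant + 0.59)) :
    ∃ N : ℕ, ∀ (K : Type) [Field K] [NumberField K], N ≤ Module.finrank ℚ K →
      θ ^ Module.finrank ℚ K ≤ ((discr K).natAbs : ℝ) := by
  have hπ0 := Real.pi_pos
  rcases hθ0.eq_or_lt with rfl | hθpos
  · refine ⟨1, fun K _ _ hn ↦ ?_⟩
    rw [zero_pow (by omega)]
    exact Nat.cast_nonneg _
  set C : ℝ := 2 * Real.pi * Real.exp (Real.eulerMascheroniConstant + 0.59) with hC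
  have hC0 : 0 < C := by positivity
  have hδ : 0 < Real.log C - Real.log θ := by
    have := Real.log_lt_log hθpos hθ
    linarith
  obtain ⟨N, hN⟩ := exists_sqrt_error_le_sixty hδ
  refine ⟨N, fun K _ _ hn ↦ ?_⟩
  have h := log_absdiscr_ge_odlyzko_signature K
  have herr := hN _ hn
  have hd : 0 < ((discr K).natAbs : ℝ) := by exact_mod_cast Int.natAbs_pos.mpr (discr_ne_zero K)
  have hrank : (nrRealPlaces K : ℝ) + 2 * nrComplexPlaces K = Module.finrank ℚ K := by
    exact_mod_cast card_add_two_mul_card_eq_rank K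
  have hr1 : (0 : ℝ) ≤ nrRealPlaces K := Nat.cast_nonneg _
  have hlogC : Real.log C = Real.log (2 * Real.pi) + Real.eulerMascheroniConstant + 0.59 := by
    rw [hC, Real.log_mul (by positivity) (Real.exp_pos _).ne', Real.log_exp, add_assoc]
  have h42 : Real.log (2 * Real.pi) + Real.eulerMascheroniConstant + 0.59 ≤
      Real.log (4 * Real.pi) + Real.eulerMascheroniConstant + 0.838 := by
    have := Real.log_le_log (by positivity : 0 < 2 * Real.pi) (by linarith : 2 * Real.pi ≤ 4 * Real.pi)
    linarith
  have e1 := mul_le_mul_of_nonneg_left h42 hr1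
  have e3 : (Module.finrank ℚ K : ℝ) * Real.log C =
      ((nrRealPlaces K : ℝ) + 2 * nrComplexPlaces K) *
        (Real.log (2 * Real.pi) + Real.eulerMascheroniConstant + 0.59) := by
    rw [hrank, hlogC]
  have hlog : (Module.finrank ℚ K : ℝ) * Real.log θ ≤ Real.log ((discr K).natAbs : ℝ) := by
    linarith [h, e1, e3, herr]
  have := Real.exp_le_exp.2 hlog
  rwa [Real.exp_nat_mul, Real.exp_log hθpos, Real.exp_log hd] at this

/-- **Asymptotic root-discriminant bound, totally real fields**: for every
`θ < 4πe^{γ+0.838} ≈ 51.74` there is `N` such that `|d_K| ≥ θ^n` for every totally real number field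
`K` of degree `n ≥ N`. [cite: Odlyzko1977, Theorem 1 (method; one-term instance)] -/
theorem exists_pow_le_absdiscr_totallyReal_of_lt_odlyzko {θ : ℝ} (hθ0 : 0 ≤ θ)
    (hθ : θ < 4 * Real.pi * Real.exp (Real.eulerMascheroniConstant + 0.838)) :
    ∃ N : ℕ, ∀ (K : Type) [Field K] [NumberField K] [IsTotallyReal K], N ≤ Module.finrank ℚ K →
      θ ^ Module.finrank ℚ K ≤ ((discr K).natAbs : ℝ) := by
  have hπ0 := Real.pi_pos
  rcases hθ0.eq_or_lt with rfl | hθpos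
  · refine ⟨1, fun K _ _ _ hn ↦ ?_⟩
    rw [zero_pow (by omega)]
    exact Nat.cast_nonneg _
  set C : ℝ := 4 * Real.pi * Real.exp (Real.eulerMascheroniConstant + 0.838) with hC
  have hC0 : 0 < C := by positivity
  have hδ : 0 < Real.log C - Real.log θ := by
    have := Real.log_lt_log hθpos hθ
    linarith
  obtain ⟨N, hN⟩ := exists_sqrt_error_le_sixty hδ
  refine ⟨N, fun K _ _ _ hn ↦ ?_⟩
  have h := log_absdiscr_ge_odlyzko_signature K
  rw [IsTotallyReal.nrComplexPlaces_eq_zero] at h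
  have herr := hN _ hn
  have hd : 0 < ((discr K).natAbs : ℝ) := by exact_mod_cast Int.natAbs_pos.mpr (discr_ne_zero K)
  have hrank : (nrRealPlaces K : ℝ) = Module.finrank ℚ K := by
    exact_mod_cast (IsTotallyReal.finrank K).symm
  have hlogC : Real.log C = Real.log (4 * Real.pi) + Real.eulerMascheroniConstant + 0.838 := by
    rw [hC, Real.log_mul (by positivity) (Real.exp_pos _).ne', Real.log_exp, add_assoc]
  have e3 : (Module.finrank ℚ K : ℝ) * Real.log C =
      (nrRealPlaces K : ℝ) * (Real.log (4 * Real.pi) + Real.eulerMascheroniConstant + 0.838) := by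
    rw [← hrank, hlogC]
  have hlog : (Module.finrank ℚ K : ℝ) * Real.log θ ≤ Real.log ((discr K).natAbs : ℝ) := by
    push_cast at h
    linarith [h, herr, e3]
  have := Real.exp_le_exp.2 hlog
  rwa [Real.exp_nat_mul, Real.exp_log hθpos, Real.exp_log hd] at this

/-! ### The degree against `log|d_K|` -/

/-- **`n ≤ (log|d_K| + 84)/log 16`** for every number field `K` of degree `n` (from
`log|d_K| ≥ n log 20.18 − π√(2n) − 60` and `2√(π²n/2) ≤ (log 20.18 − log 16) n + 24`; the tree's
Stark-type slope was `1/log 2π ≈ 0.54`, here `1/log 16 ≈ 0.36`). [cite: Odlyzko1977, Theorem 1 (method)] -/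
theorem finrank_le_log_absdiscr_odlyzko :
    (Module.finrank ℚ K : ℝ) ≤ (Real.log ((discr K).natAbs : ℝ) + 84) / Real.log 16 := by
  have h := log_absdiscr_ge_odlyzko_signature K
  have hπ0 := Real.pi_pos
  have hπ := Real.pi_lt_d2
  set n : ℕ := Module.finrank ℚ K with hn_def
  have hrank : (nrRealPlaces K : ℝ) + 2 * nrComplexPlaces K = n := by
    rw [hn_def]; exact_mod_cast card_add_two_mul_card_eq_rank K
  have hr1 : (0 : ℝ) ≤ nrRealPlaces K := Nat.cast_nonneg _
  have hn0 : (0 : ℝ) ≤ n := Nat.cast_nonneg _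
  have hlog16 : 0 < Real.log 16 := Real.log_pos (by norm_num)
  -- the per-place constants exceed `log 20.18 > log 16`
  have hC2 : Real.log (20.18 : ℝ) < Real.log (2 * Real.pi) + Real.eulerMascheroniConstant + 0.59 := by
    have := Real.log_lt_log (by norm_num) lt_two_pi_exp_gain
    rwa [Real.log_mul (by positivity) (Real.exp_pos _).ne', Real.log_exp, ← add_assoc] at this
  have h42 : Real.log (2 * Real.pi) + Real.eulerMascheroniConstant + 0.59 ≤
      Real.log (4 * Real.pi) + Real.eulerMascheroniConstant + 0.838 := by
    have := Real.log_le_log (by positivity : 0 < 2 * Real.pi) (by linarith : 2 * Real.pi ≤ 4 * Real.pi)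
    linarith
  -- `log 20.18 − log 16 ≥ 0.232`
  have hgap : (0.232 : ℝ) ≤ Real.log (20.18 : ℝ) - Real.log 16 := by
    rw [← Real.log_div (by norm_num) (by norm_num)]
    have h1 : Real.exp (0.232 : ℝ) ≤ 20.18 / 16 := by
      have hb := Real.exp_bound' (x := (0.232 : ℝ)) (by norm_num) (by norm_num) (n := 4) (by norm_num)
      have : (∑ i ∈ Finset.range 4, (0.232 : ℝ) ^ i / (i.factorial : ℝ)) +
          (0.232 : ℝ) ^ 4 * (4 + 1) / ((4 : ℕ).factorial * 4) ≤ 20.18 / 16 := by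
        simp only [Finset.sum_range_succ, Finset.sum_range_zero, Nat.factorial]
        norm_num
      linarith
    have := Real.log_le_log (Real.exp_pos _) h1
    rwa [Real.log_exp] at this
  -- `2 s ≤ 0.232 n + 24` with `s = √(π²n/2)` (`s² = π² n/2 < 4.97 n ≤ (0.116 n + 12)²`)
  set s : ℝ := Real.sqrt (Real.pi ^ 2 * n / 2) with hs_def
  have ht0 : (0 : ℝ) ≤ 0.116 * n + 12 := by positivity
  have hsn : s ≤ 0.116 * n + 12 := by
    have hπ2 : Real.pi ^ 2 ≤ 9.9225 := by nlinarith
    have hπn : Real.pi ^ 2 * n ≤ 9.9225 * n := mul_le_mul_of_nonneg_right hπ2 hn0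
    have hle : Real.pi ^ 2 * n / 2 ≤ (0.116 * n + 12) ^ 2 := by
      nlinarith [sq_nonneg ((n : ℝ) - 82), hπn, hn0]
    calc s ≤ Real.sqrt ((0.116 * n + 12) ^ 2) := Real.sqrt_le_sqrt hle
      _ = 0.116 * n + 12 := Real.sqrt_sq ht0
  rw [le_div_iff₀ hlog16]
  have e1 := mul_le_mul_of_nonneg_left h42 hr1
  have p1 := mul_le_mul_of_nonneg_left hC2.le hn0
  have p2 := mul_le_mul_of_nonneg_left hgap hn0
  have e3 : (n : ℝ) * (Real.log (2 * Real.pi) + Real.eulerMascheroniConstant + 0.59) =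
      (nrRealPlaces K : ℝ) * (Real.log (2 * Real.pi) + Real.eulerMascheroniConstant + 0.59) +
        2 * (nrComplexPlaces K : ℝ) * (Real.log (2 * Real.pi) + Real.eulerMascheroniConstant + 0.59) := by
    rw [← hrank]; ring
  linarith [e1, h, p1, p2, e3, hsn]

end OdlyzkoBound

end Summit.QuantumAdvantage.QuantumAdvantage.Theorems.DegreeOnePrimesEscape
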